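import Literature.MathematicalPhysics.QuantumFieldTheory.Balaban1983to89.B8Thm4KLevelGamma
import HarnessLib

/-!
# Line H (`BirthV10.stub_halvingStep`, stmt-QuantumFields-19200) — BOARD v7 (cure (R-a-β) of LOCATED DISPLAY DEFECT №10), row (γ-1) = T1 of LEAD-H WORD 21 (THIN ROAD γ; insurance road per ★★OWNER RULING g28-№11):
# ★★★ THE [R-h] CALLER RE-PLUMBED — [Balaban1985RegularSpaces] PROPOSITION 3 AT `k` LEVELS APPLIED ONCE TO THE TOP GAUGE-FIXED FIELD, BOTH MEMBERS KEPT,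
# THE (1.59) IN-EDGE IN EDITION γ (`H59γ`: the β-shaped clause — averaging datum over `Λb ∪ {level-0 crossing bonds of Ω₀}`, exterior-collar allowance `+ B_∂·Φ₀(A′)`,
# support clause — over a PARAMETRIC class `Λb` under PRINT's box law «box ⊂ Ω_{j−1}» with [3] Prop. 4's windows one level lower),
# (the level-cube sizes (hX1)∕(hX2) follow in the sequel)

Twin of ✓`HalvingP1FlatCoreTopSizes` (`Theorems/UnitScaleTiltHalvingP1FlatCoreTopSizes.lean`, ★w6-19200 g2) with EXACTLY ONE displayed socket re-typed: the (1.59)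
in-edge `H59` — stated there in the `msup … SideTouches (Ω j) …`-LHS ∕ constraint-bonds-only-RHS currency, which pub-ymgap dag-n05-e∕dag-n06-b certified
UNSATISFIABLE at every finite-`Ω₀` cube member (lit ✓`B8SockH59CornerDefect.h59_body_false_of_corner`, ✓`B8SockH59NotAtCube.not_sockH59_cubeMember`,
✓`B9SupplySockB9P3ZdSocketBoundaryMode.not_sockB9P3D4_cube`; cell certificate ✓p677242 `…HalvingHSB9AllNotAtCubeMember`; ★★OWNER RULING g28-№10 + AMENDMENT)
— becomes `H59γ`, the (1.59) clause IN EDITION γ of record (LEAD-H WORDS 17∕21; lit ✓`B8Thm4KLevelGamma.hP3_gaugeFixed_of_b9_γ` :137's `H59Dβ` over the parametric class, γ box law, at the single level `m := k`;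
at the cube member the class is print's `cubeLamBP`, lit ✓`B8Ineq159FlatCubeMemberPrinted` :106, box law by lit ✓`cubeLamBP_box_subset_pred` :237; β at `cubeLamB` is vacuous, lit p572834):
same LHS, RHS `B₀·(|J|₍₋₃₎ + |B₁|β) + B_∂·Φ₀(A′)` with `|B₁|β` over `Λb k j ∪ {level-0 CROSSING bonds of Ω₀}` (lit ✓`B9SupplySockB9P3ZdBeta.CrossB`) and the
exterior-collar term `Φ₀(A′) = msup` of `A′` over the level-0 sides of `Ω₀` that are NOT bonds of `Ω₀`, under the datum's SUPPORT clause `u = 1` off `Ω₀`.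
New scalar binders (lit's, verbatim): `0 ≤ B_∂`, `0 ≤ a ≤ 1∕4`, `4·B_∂·a ≤ (dL − 1)·B₀·(α₀ + α₁)` (the slack of (1.60) ⇒ (1.62)), `a ≤ dL·α₁`; [3]-Prop.-4 WINDOWS SHIFTED to
`(L²α₀, L·α₂)` (`hα3 hα4 hsmall hc₃`, `C₂ ≥ …·e^{…L²α₀}·L²`) and the box law `hbox : … → x ∈ Ω (j − 1)` (lit :137 letter for letter); new rows: (1.66)₀
`h66 : ‖U′ − 1‖ ≤ a` on the sides touching `Ω₀`, the boundary-layer law `hlay` (at the cube member of (1.131) a THEOREM: lit ✓`B8LeafKnitZd3CubBdryBeta.bdryLayer_cubeMember`),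
and the support clause `huS` of the datum's gauge transformation.  SAME CONCLUSION as ✓`prop3_sizes_top` (letter for letter), SAME constant
`c⋆ = 5dLB₀(α₀ + α₁)` — so ✓p647823 `hX_of_topRows` ∕ ✓p654113 `siteSizeRows_of_topRows` re-plumb on this file with `H59 ↦ H59γ` + the new rows threaded (T3∕T4, w2-19936 g9).

Cell `ym3-torus` (HUMAN RULING D-0037: YM₃ on T³ is ladder rung R3 — NOT d = 4, NOT a mass gap, NOT the Clay problem), width seat `ym-ust-20520-w3` gen 8 (LEAD-H ★w5-19200 g6
H-NAMER WORDS 14∕15∕21 «(γ-1) → ★w3-20520»).  `--supports stmt-QuantumFields-19200 --as helper`; THEOREMS ONLY (0 `def`, 0 `sorry`); count-neutral; nothing here claims Prop. 3,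
[4] Thm 3.3, `hP1room`, the stub, the crux or the gap.

WHAT.
* §1 (any `ℤᵈ`, `d ≥ 2`, C⋆-algebra `𝔸`) ★★★`prop3_sizes_top_γ` — lit ✓`hP3_gaugeFixed_of_b9_γ`'s proof REPLAYED AT THE SINGLE LEVEL `m = k` with the (1.42) clause
  `H42` and the γ in-edge `H59γ` displayed AT LEVEL `k` ONLY and with Proposition 3's SECOND member KEPT: for the datum `(u, W, A)` with `u` unitary-valued AND `u = 1` off `Ω₀`,
  `W^{u} = U′`, (1.29), `Lan k W`, and the a priori chart row `W = e^{iηA}`, `‖A‖ ≤ (2Lc⋆+8α₄)(Lʲη)⁻¹` on the sides touching `Ω_j`, there is the masked exponent field `A′`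
  (self-adjoint, `= A` on those sides) with `‖A‖ ≤ c⋆(Lʲη)⁻¹` there AND `(Lʲη)²‖∇^η_{U₀,κ}A′_τ(y)‖ ≤ c⋆` whenever `SideTouches (Ω j) y τ`.  THE ONE STEP beyond n05-b's
  bootstrap (lit's, re-run here): on a level-0 side `b` of `Ω₀` not fully inside `Ω₀`, `u = 1` at both end-points (outer: support; inner: `hlay` + (1.29)₀), so `W(b) = U′(b)`
  and `η‖A′(b)‖ = ‖log U′(b)‖ ≤ 2‖U′(b) − 1‖ ≤ 2a` — this bounds BOTH the crossing terms of `|B₁|β` (inside «|B₁| < 2dLα₁ + C₂α₂²» by `a ≤ dLα₁`) and the collar term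
  (`Φ₀ ≤ 2a`, absorbed by `4B_∂a ≤ (dL−1)B₀(α₀+α₁)` through lit ✓`B8Prop3KLevelBdry.apriori_160_bdry`∕`apriori_162_bdry`); the constraint terms by lit
  ✓`B8Thm4KLevelGamma.norm_B1_lt_kLevel_γ` (γ box law, shifted windows).
* (sequels, w2-19936 g9's T3∕T4) the level-cube reading at `U₀ = 1`, `hX_of_topRows_γ` (✓p647823 twin) and `siteSizeRows_of_topRows_γ` (✓p654113 twin).
HONEST SCOPE.  By-name re-run of lit's β bootstrap at one level; every analytic row stays DISPLAYED: (1.33)∕(1.34) `InAk`, the (1.42) clause `H42`, the γ in-edge `H59γ`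
(= [4] Thm 3.3 for `G(U₀)` on the finite region WITH exterior data, β-shaped over the parametric class — A6: its satisfiability depends on the class supplied: at print's
class `cubeLamBP` it is print's (1.59), lit A6 witness ✓`B9SupplySockB9P3ZdGamma` at truncation 0; at a «box ⊂ Ω_j» class it is FALSE (p572834); no satisfiability claim here —
this file displays no member), the shifted windows at `α₂ = 2Lc⋆ + 8α₄`, (1.66)₀ `h66`, `hlay`, the scalar side conditions.  Nothing of Proposition 3 ∕ [4] is
re-proved; nothing of `core′`, the stub or the crux.

References: T. Bałaban, CMP **99** (1985) 75–102 [Balaban1985RegularSpaces] (Prop. 3 p.87, (1.55)–(1.62) pp.86–87, (1.29)∕(1.31)∕(1.36) pp.81–82, (1.40)–(1.42) p.83, (1.66) p.87, Thm 4 p.88);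
CMP **99** (1985) 389–434 [Balaban1985BackgroundPropagators] (Thm 3.3 p.399, (3.16) p.393); CMP **96** (1984) 223–250 [Balaban1984PropagatorsII] ((2.3) p.224).
-/

set_option autoImplicit false

noncomputable section

open scoped BigOperators Matrix.Norms.L2Operator
open NormedSpace

namespace Summit.QuantumFields.YangMills.Theorems.HalvingP1FlatCoreTopSizesGamma

open Literature.MathematicalPhysics.QuantumFieldTheory.Balaban1983to89
open Complex (I I_ne_zero)
open MatrixLog B7Prop1Explicit B7Prop2Explicit B7Prop1Local B7Eq92Concrete
open B7Prop1Explicit renaming Site → LSite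
open B8Lemma1NonAbelian (mulCfg)
open B8Ineq132 (covDerivFwd InAk BondTouches)
open B8Eq140Level (SideTouches)
open B8Eq119TwistedAxial (Restr129)
open B8Eq184Proof (gaugeExp cfgExp)
open B8Eq146AExpansion (iEta expCfg)
open B7Prop4GeneralLevels (logCovIter linCovIter)
open B8Eq155JBound (Jcur wsup)
open B8ScaledSupNorm (bondNorm msup weight Bdd)
open B7Prop3Flat (c3)
open B7Eq78Linearization (conjR)
open B9SupplySockB9P3ZdBeta (CrossB)
open B8Thm4KLevelGamma (norm_B1_lt_kLevel_γ)
open B8Prop3GaugeFixedKLevel (logField_spec mem_unitaryUnits_of_mgauge_eq mulCfg_eq_gaugeAct_of_mgauge_eq inAk_congr_of_sideTouches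
  expCfg_iEta_eq_cfgExp cfgExp_congr_at)

variable {d : ℕ}

/-! ## §1 Proposition 3 at `k` levels for the top gauge-fixed field, both members, the (1.59) in-edge in edition β -/

section Generic

variable {𝔸 : Type*} [CStarAlgebra 𝔸] [Nontrivial 𝔸]

/-- ★★★ **PROPOSITION 3 AT `k` LEVELS, APPLIED ONCE, BOTH MEMBERS, THE (1.59) IN-EDGE IN EDITION γ** (lit ✓`hP3_gaugeFixed_of_b9_γ`'s replay at the single level
`m = k`, second member kept; twin of ✓`HalvingP1FlatCoreTopSizes.prop3_sizes_top` with `H59 ↦ H59γ`, the γ box law `hbox … ∈ Ω (j−1)`, [3]-Prop.-4 windows at `(L²α₀, L·α₂)`,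
`{Bbd a} hBbd ha0 ha hbdry haα h66 hlay` + the support clause `huS`):
for a datum `(u, W, A)` — `u` unitary-valued, `u = 1` off `Ω₀`, `W^{u} = U′`, (1.29) `Restr129 L k (Λs k) U₀ u`, `Lan k W`, and on every side touching `Ω_j` (`j ≤ k`) the chart
row `W = e^{iηA}` with the A PRIORI size `‖A‖ ≤ (2Lc⋆ + 8α₄)(Lʲη)⁻¹` — under (1.33)∕(1.34), the level-`k` (1.42) clause `H42`, the γ in-edge `H59γ` (per `(u, W, A′)`, support
clause, `|B₁|β` over `Λb k j ∪` the level-0 crossing bonds of `Ω₀`, collar allowance `B_∂·Φ₀(A′)`), (1.66)₀ `h66`, the boundary-layer law `hlay`, `a ≤ dLα₁`,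
`4B_∂a ≤ (dL − 1)B₀(α₀ + α₁)` and the windows of Prop. 3 at `α₂ = 2Lc⋆ + 8α₄`: the masked exponent field `A′ = (1∕iη) log W` on `⋃_{j ≤ k} SideTouches (Ω j)` (`0` off it) is
self-adjoint everywhere, equals `A` on those sides, and BOTH (1.62)₁ `‖A‖ ≤ c⋆(Lʲη)⁻¹` there AND (1.62)₂ `(Lʲη)²‖∇^η_{U₀,κ}A′_τ(y)‖ ≤ c⋆` for `SideTouches (Ω j) y τ` hold,
`c⋆ = 5dLB₀(α₀ + α₁)`.
[cite: Balaban1985RegularSpaces, Prop. 3 p.87, (1.55)-(1.62) pp.86-87, (1.29) p.81, (1.31) p.82, (1.36) p.82, (1.40)-(1.42) p.83, (1.66) p.87, Thm 4 p.88, p.77; Balaban1985BackgroundPropagators, Thm 3.3 p.399, (3.16) p.393] -/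
theorem prop3_sizes_top_γ (hd2 : 2 ≤ d) {η : ℝ} (hη : 0 < η) {L : ℕ} (hL : 2 ≤ L) (k : ℕ)
    {U₀ U' : LSite d → Fin d → 𝔸ˣ} (hU₀ : ∀ x κ, U₀ x κ ∈ unitaryUnits 𝔸) (hU' : ∀ x κ, U' x κ ∈ unitaryUnits 𝔸)
    {α₀ α₁ α₄ B₀ cstar : ℝ} (hα₀ : 0 < α₀) (hα₁ : 0 ≤ α₁) (hα₄ : 0 ≤ α₄) (hB₀ : 0 ≤ B₀)
    (hc : cstar = 5 * d * L * B₀ * (α₀ + α₁))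
    -- [3] Prop. 4's linearisation windows ONE LEVEL LOWER (edition γ: the box of a level-`j` datum bond lies in `Ω_{j−1}`; lit :137's letters)
    (hα3 : C0 d * ((L : ℝ) ^ 2 * α₀) ≤ 1 / 3) (hα4 : 4 * ((L : ℝ) ^ 2 * α₀) ≤ c2' d L)
    (h16 : 16 * (2 * (L * cstar) + 8 * α₄) ≤ 1) (hd5 : 5 * (2 * (L * cstar) + 8 * α₄) * ((d : ℝ) - 1) ≤ 4)
    (hsmall : Real.exp (4 * (800 * ((d : ℝ) + 1) ^ 2 * ((d : ℝ) + 4)) * ((L : ℝ) ^ 2 * α₀))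
      * (1 + 8 * (131072 * ((d : ℝ) + 1) ^ 2) * ((L : ℝ) * (2 * (L * cstar) + 8 * α₄))) ≤ 2)
    (hc₃ : 2 * ((L : ℝ) * (2 * (L * cstar) + 8 * α₄)) ≤ c3 d L) (hside : 36 * d * B₀ * (2 * (L * cstar) + 8 * α₄) ≤ 1 / 2)
    (h50 : 50 * d * (2 * (L * cstar) + 8 * α₄) ≤ 1)
    {C₂ : ℝ} (hC₂ : 8 * (131072 * ((d : ℝ) + 1) ^ 2) * Real.exp (4 * (800 * ((d : ℝ) + 1) ^ 2 * ((d : ℝ) + 4)) * ((L : ℝ) ^ 2 * α₀)) * (L : ℝ) ^ 2 ≤ C₂)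
    (h61 : 2 * (2 * (L * cstar) + 8 * α₄) ^ 2 + 20 * d * α₀ * (2 * (L * cstar) + 8 * α₄)
      + 2 * C₂ * (2 * (L * cstar) + 8 * α₄) ^ 2 ≤ α₀ + α₁)
    -- the exterior-collar constant `B_∂`, the (1.66)₀ level `a` and the absorption window (lit's binders, verbatim)
    {Bbd a : ℝ} (hBbd : 0 ≤ Bbd) (ha0 : 0 ≤ a) (ha : a ≤ 1 / 4) (hbdry : 4 * Bbd * a ≤ ((d : ℝ) * L - 1) * B₀ * (α₀ + α₁))
    (haα : a ≤ (d : ℝ) * L * α₁)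
    (Ω : ℕ → Set (LSite d)) (Λs : ℕ → ℕ → Set (LSite d)) (Λb : ℕ → ℕ → Set (LSite d × Fin d))
    -- PRINT's box law (edition γ, lit :137): the locality box of a level-`j` datum bond lies in `Ω_{j−1}` ((1.31); [B6] (2.3); level 0: `Ω₀`)
    (hbox : ∀ j, j ≤ k → ∀ c ∈ Λb k j, ∀ x, InBox (loK L j c.1) (bondHiK L j c.1 c.2) x → x ∈ Ω (j - 1))
    (h33 : InAk L k η α₀ Ω U₀) (h34 : InAk L k η α₀ Ω (mulCfg U' U₀))
    -- (1.66)₀ on the sides touching `Ω₀`, and the boundary-layer law at level `k` (lit ✓`bdryLayer_cubeMember` at the cube member)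
    (h66 : ∀ b ∈ {b : LSite d × Fin d | SideTouches (Ω 0) b.1 b.2}, ‖((U' b.1 b.2 : 𝔸ˣ) : 𝔸) - 1‖ ≤ a)
    (hlay : ∀ y z : LSite d, y ∈ Ω 0 → z ∉ Ω 0 → (∀ i, y i - 1 ≤ z i ∧ z i ≤ y i + 1) → y ∈ Λs k 0)
    (Lan : ℕ → (LSite d → Fin d → 𝔸ˣ) → Prop)
    (H42 : ∀ (u : LSite d → 𝔸ˣ) (W : LSite d → Fin d → 𝔸ˣ) (A' : LSite d → Fin d → 𝔸),
      (∀ x, u x ∈ unitaryUnits 𝔸) → mgauge U₀ u W = U' → Restr129 L k (Λs k) U₀ u → Lan k W →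
      (∀ y τ, IsSelfAdjoint (A' y τ)) →
      (∀ j, j ≤ k → ∀ y τ, SideTouches (Ω j) y τ →
        W y τ = cfgExp η A' y τ ∧ ‖A' y τ‖ ≤ (2 * (L * cstar) + 8 * α₄) * ((L : ℝ) ^ j * η)⁻¹) →
      (∀ y τ, (∀ j, j ≤ k → ¬ SideTouches (Ω j) y τ) → A' y τ = 0) →
      ∀ j, j ≤ k → ∀ c ∈ Λb k j, ‖logCovIter L U₀ (iEta η A') j c.1 c.2‖ < 2 * d * L * α₁)
    -- THE (1.59) IN-EDGE IN EDITION γ at level `k` (lit ✓`B8Thm4KLevelGamma.hP3_gaugeFixed_of_b9_γ`'s `H59Dβ` at `m := k` over the parametric class): support clause, `|B₁|β`, collar term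
    (H59γ : ∀ (u : LSite d → 𝔸ˣ) (W : LSite d → Fin d → 𝔸ˣ) (A' : LSite d → Fin d → 𝔸),
      (∀ x, u x ∈ unitaryUnits 𝔸) → (∀ x, x ∉ Ω 0 → u x = 1) → mgauge U₀ u W = U' → Restr129 L k (Λs k) U₀ u → Lan k W →
      (∀ y τ, IsSelfAdjoint (A' y τ)) →
      (∀ j, j ≤ k → ∀ y τ, SideTouches (Ω j) y τ →
        W y τ = cfgExp η A' y τ ∧ ‖A' y τ‖ ≤ (2 * (L * cstar) + 8 * α₄) * ((L : ℝ) ^ j * η)⁻¹) →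
      (∀ y τ, (∀ j, j ≤ k → ¬ SideTouches (Ω j) y τ) → A' y τ = 0) →
      msup L k η (-(1 : ℝ)) (fun j (b : LSite d × Fin d) => SideTouches (Ω j) b.1 b.2) (fun b => A' b.1 b.2)
          ≤ B₀ * (bondNorm L k η (-(3 : ℝ)) Ω (fun x μ => Jcur η U₀ A' μ x)
            + wsup 1 (fun p : {p : ℕ × (LSite d × Fin d) // p.1 ≤ k ∧ (p.2 ∈ Λb k p.1 ∨ (p.1 = 0 ∧ CrossB (Ω 0) p.2))} =>
                linCovIter L U₀ (iEta η A') p.1.1 p.1.2.1 p.1.2.2))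
            + Bbd * msup L k η (-(1 : ℝ)) (fun j (b : LSite d × Fin d) => j = 0 ∧ SideTouches (Ω 0) b.1 b.2 ∧ ¬ BondTouches (Ω 0) b.1 b.2)
                (fun b => A' b.1 b.2) ∧
        msup L k η (-(2 : ℝ)) (fun j (t : Fin d × Fin d × LSite d) => SideTouches (Ω j) t.2.2 t.2.1)
            (fun t => covDerivFwd η U₀ t.1 (fun z => A' z t.2.1) t.2.2)
          ≤ B₀ * (bondNorm L k η (-(3 : ℝ)) Ω (fun x μ => Jcur η U₀ A' μ x)
            + wsup 1 (fun p : {p : ℕ × (LSite d × Fin d) // p.1 ≤ k ∧ (p.2 ∈ Λb k p.1 ∨ (p.1 = 0 ∧ CrossB (Ω 0) p.2))} =>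
                linCovIter L U₀ (iEta η A') p.1.1 p.1.2.1 p.1.2.2))
            + Bbd * msup L k η (-(1 : ℝ)) (fun j (b : LSite d × Fin d) => j = 0 ∧ SideTouches (Ω 0) b.1 b.2 ∧ ¬ BondTouches (Ω 0) b.1 b.2)
                (fun b => A' b.1 b.2))
    (u : LSite d → 𝔸ˣ) (W : LSite d → Fin d → 𝔸ˣ) (A : LSite d → Fin d → 𝔸)
    (hu : ∀ x, u x ∈ unitaryUnits 𝔸) (huS : ∀ x, x ∉ Ω 0 → u x = 1) (hW : mgauge U₀ u W = U') (h129 : Restr129 L k (Λs k) U₀ u) (hLan : Lan k W)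
    (hWA : ∀ j, j ≤ k → ∀ y τ, SideTouches (Ω j) y τ →
      W y τ = cfgExp η A y τ ∧ ‖A y τ‖ ≤ (2 * (L * cstar) + 8 * α₄) * ((L : ℝ) ^ j * η)⁻¹) :
    ∃ A' : LSite d → Fin d → 𝔸, (∀ y τ, IsSelfAdjoint (A' y τ)) ∧
      (∀ j, j ≤ k → ∀ y τ, SideTouches (Ω j) y τ → A' y τ = A y τ) ∧
      (∀ j, j ≤ k → ∀ y τ, SideTouches (Ω j) y τ → ‖A y τ‖ ≤ cstar * ((L : ℝ) ^ j * η)⁻¹) ∧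
      (∀ j, j ≤ k → ∀ (y : LSite d) (κ τ : Fin d), SideTouches (Ω j) y τ →
        ((L : ℝ) ^ j * η) ^ 2 * ‖covDerivFwd η U₀ κ (fun z => A' z τ) y‖ ≤ cstar) := by
  classical
  have hL1 : 1 ≤ L := le_trans (by norm_num) hL
  have hLr : (1 : ℝ) ≤ L := by exact_mod_cast hL1
  set α₂ : ℝ := 2 * (L * cstar) + 8 * α₄ with hα₂_def
  have hcstar : 0 ≤ cstar := by rw [hc]; positivity
  have hα₂ : 0 ≤ α₂ := by positivity
  have hα₂16 : α₂ ≤ 1 / 16 := by linarith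
  -- `W` is unitary-valued
  have hWu : ∀ x κ, W x κ ∈ unitaryUnits 𝔸 := mem_unitaryUnits_of_mgauge_eq hU₀ hU' hu hW
  -- the bonds where the socket delivers `W = e^{iηA}`
  set M : Set (LSite d × Fin d) := {b | ∃ j, j ≤ k ∧ SideTouches (Ω j) b.1 b.2} with hM_def
  -- the masked exponent field `A′ := (1/iη) log W` on `M`, `0` elsewhere
  set A' : LSite d → Fin d → 𝔸 :=
    fun y τ => M.indicator (fun b : LSite d × Fin d => η⁻¹ • ((I⁻¹ : ℂ) • mlog ((W b.1 b.2 : 𝔸ˣ) : 𝔸))) (y, τ) with hA'_def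
  -- on a socket bond: `A′ = A`, self-adjoint, `W = e^{iηA′}`
  have hsock : ∀ j, j ≤ k → ∀ y τ, SideTouches (Ω j) y τ →
      A' y τ = A y τ ∧ IsSelfAdjoint (A' y τ) ∧ W y τ = cfgExp η A' y τ := by
    intro j hj y τ hs
    have hmem : (y, τ) ∈ M := ⟨j, hj, hs⟩
    obtain ⟨hWA₁, hA₁⟩ := hWA j hj y τ hs
    have hLj : (1 : ℝ) ≤ (L : ℝ) ^ j := one_le_pow₀ hLr
    have hA₂ : ‖A y τ‖ ≤ α₂ * η⁻¹ := by
      calc ‖A y τ‖ ≤ α₂ * ((L : ℝ) ^ j * η)⁻¹ := hA₁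
        _ = α₂ * η⁻¹ * ((L : ℝ) ^ j)⁻¹ := by rw [mul_inv]; ring
        _ ≤ α₂ * η⁻¹ * 1 := by
            apply mul_le_mul_of_nonneg_left (inv_le_one_of_one_le₀ hLj) (by positivity)
        _ = α₂ * η⁻¹ := mul_one _
    obtain ⟨hlog, hsa, hexp⟩ := logField_spec hη U₀ hWu hWA₁ hA₂ hα₂16
    have hA'y : A' y τ = η⁻¹ • ((I⁻¹ : ℂ) • mlog ((W y τ : 𝔸ˣ) : 𝔸)) := by
      simp only [hA'_def, Set.indicator_of_mem hmem]
    refine ⟨by rw [hA'y, hlog], by rw [hA'y]; exact hsa, ?_⟩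
    rw [hexp]
    exact cfgExp_congr_at η hA'y.symm
  have hA'0 : ∀ y τ, (∀ j, j ≤ k → ¬ SideTouches (Ω j) y τ) → A' y τ = 0 := by
    intro y τ h
    have hnot : (y, τ) ∉ M := fun ⟨j, hj, hs⟩ => h j hj hs
    simp only [hA'_def, Set.indicator_of_notMem hnot]
  have hA'sa : ∀ y τ, IsSelfAdjoint (A' y τ) := by
    intro y τ
    by_cases hmem : (y, τ) ∈ M
    · obtain ⟨j, hj, hs⟩ := hmem
      exact (hsock j hj y τ hs).2.1
    · have : A' y τ = 0 := by simp only [hA'_def, Set.indicator_of_notMem hmem]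
      rw [this]; exact IsSelfAdjoint.zero 𝔸
  have hA'41 : ∀ j, j ≤ k → ∀ y τ, SideTouches (Ω j) y τ →
      W y τ = cfgExp η A' y τ ∧ ‖A' y τ‖ ≤ α₂ * ((L : ℝ) ^ j * η)⁻¹ := by
    intro j hj y τ hs
    obtain ⟨hAA, -, hWe⟩ := hsock j hj y τ hs
    exact ⟨hWe, by rw [hAA]; exact (hWA j hj y τ hs).2⟩
  -- global bound `‖A′‖ ≤ α₂η⁻¹`
  have hA'glob : ∀ y τ, ‖A' y τ‖ ≤ α₂ * η⁻¹ := by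
    intro y τ
    by_cases hmem : (y, τ) ∈ M
    · obtain ⟨j, hj, hs⟩ := hmem
      have hLj : (1 : ℝ) ≤ (L : ℝ) ^ j := one_le_pow₀ hLr
      calc ‖A' y τ‖ ≤ α₂ * ((L : ℝ) ^ j * η)⁻¹ := (hA'41 j hj y τ hs).2
        _ = α₂ * η⁻¹ * ((L : ℝ) ^ j)⁻¹ := by rw [mul_inv]; ring
        _ ≤ α₂ * η⁻¹ * 1 := by
            apply mul_le_mul_of_nonneg_left (inv_le_one_of_one_le₀ hLj) (by positivity)
        _ = α₂ * η⁻¹ := mul_one _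
    · have : A' y τ = 0 := by simp only [hA'_def, Set.indicator_of_notMem hmem]
      rw [this, norm_zero]; positivity
  -- the in-edge (1.59) and the (1.42) clause for `A′`
  obtain ⟨h59a, h59g⟩ := H59γ u W A' hu huS hW h129 hLan hA'sa hA'41 hA'0
  have h42 := H42 u W A' hu hW h129 hLan hA'sa hA'41 hA'0
  -- (1.40) for `U₀` and for `e^{iηA′}U₀` at the `k` levels
  have h40₀ : InAk L k η α₀ Ω U₀ := h33
  have h40W : InAk L k η α₀ Ω (mulCfg W U₀) := by
    have h1 : InAk L k η α₀ Ω (mulCfg U' U₀) := h34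
    have hui : ∀ x, u⁻¹ x ∈ U1 𝔸 := fun x => unitaryUnits_le_U1 ((unitaryUnits 𝔸).inv_mem (hu x))
    rw [mulCfg_eq_gaugeAct_of_mgauge_eq hW]
    exact (B8Ineq132.inAk_gaugeAct_iff L k η α₀ Ω hui _).2 h1
  have h40₁ : InAk L k η α₀ Ω (mulCfg (expCfg (iEta η A')) U₀) := by
    refine (inAk_congr_of_sideTouches L k η α₀ (V := mulCfg W U₀) fun j hj y τ hs => ?_).1 h40W
    show W y τ * U₀ y τ = expCfg (iEta η A') y τ * U₀ y τ
    rw [(hA'41 j hj y τ hs).1, expCfg_iEta_eq_cfgExp]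
  -- boundedness of the two weighted families and the gradient datum
  have hBa : Bdd L k η (-(1 : ℝ)) (fun j (b : LSite d × Fin d) => SideTouches (Ω j) b.1 b.2) fun b => A' b.1 b.2 := by
    have e1 : (-(1 : ℝ)) = -((1 : ℕ) : ℝ) := by norm_num
    rw [e1]
    refine B8ScaledSupNorm.bdd_of_forall (c := α₂) fun j hj b hb => ?_
    have hs : 0 < (L : ℝ) ^ j * η := B8ScaledSupNorm.scale_pos hL1 hη j
    rw [B8ScaledSupNorm.weight_neg_natCast L η 1 j, pow_one]
    calc (L : ℝ) ^ j * η * ‖A' b.1 b.2‖ ≤ (L : ℝ) ^ j * η * (α₂ * ((L : ℝ) ^ j * η)⁻¹) :=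
        mul_le_mul_of_nonneg_left (hA'41 j hj b.1 b.2 hb).2 hs.le
      _ = α₂ := by field_simp
  have hU₀1 : ∀ x κ, U₀ x κ ∈ U1 𝔸 := fun x κ => unitaryUnits_le_U1 (hU₀ x κ)
  have hgrad : ∀ (y : LSite d) (κ τ : Fin d), ‖covDerivFwd η U₀ κ (fun z => A' z τ) y‖ ≤ 2 * α₂ * η⁻¹ * η⁻¹ := by
    intro y κ τ
    unfold covDerivFwd
    rw [norm_smul, norm_inv, Real.norm_eq_abs, abs_of_pos hη]
    have h1 : ‖conjR (U₀ y κ) (A' (y + e κ) τ) - A' y τ‖ ≤ α₂ * η⁻¹ + α₂ * η⁻¹ := by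
      calc ‖conjR (U₀ y κ) (A' (y + e κ) τ) - A' y τ‖
          ≤ ‖conjR (U₀ y κ) (A' (y + e κ) τ)‖ + ‖A' y τ‖ := norm_sub_le _ _
        _ ≤ α₂ * η⁻¹ + α₂ * η⁻¹ := by
            rw [B8Ineq132.norm_conjR (hU₀1 y κ)]
            exact add_le_add (hA'glob _ _) (hA'glob _ _)
    calc η⁻¹ * ‖conjR (U₀ y κ) (A' (y + e κ) τ) - A' y τ‖ ≤ η⁻¹ * (α₂ * η⁻¹ + α₂ * η⁻¹) :=
        mul_le_mul_of_nonneg_left h1 (by positivity)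
      _ = 2 * α₂ * η⁻¹ * η⁻¹ := by ring
  have hBg : Bdd L k η (-(2 : ℝ)) (fun j (t : Fin d × Fin d × LSite d) => SideTouches (Ω j) t.2.2 t.2.1)
      (fun t => covDerivFwd η U₀ t.1 (fun z => A' z t.2.1) t.2.2) := by
    have e2 : (-(2 : ℝ)) = -((2 : ℕ) : ℝ) := by norm_num
    rw [e2]
    refine B8ScaledSupNorm.bdd_of_forall (c := 2 * α₂ * ((L : ℝ) ^ k) ^ 2) fun j hj t _ => ?_
    rw [B8ScaledSupNorm.weight_neg_natCast L η 2 j]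
    have hLjm : (L : ℝ) ^ j ≤ (L : ℝ) ^ k := pow_le_pow_right₀ hLr hj
    have hLj0 : (0 : ℝ) ≤ (L : ℝ) ^ j := by positivity
    calc ((L : ℝ) ^ j * η) ^ 2 * ‖covDerivFwd η U₀ t.1 (fun z => A' z t.2.1) t.2.2‖
        ≤ ((L : ℝ) ^ j * η) ^ 2 * (2 * α₂ * η⁻¹ * η⁻¹) := mul_le_mul_of_nonneg_left (hgrad _ _ _) (by positivity)
      _ = 2 * α₂ * ((L : ℝ) ^ j) ^ 2 := by field_simp
      _ ≤ 2 * α₂ * ((L : ℝ) ^ k) ^ 2 := by gcongr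
  set g : ℝ := msup L k η (-(2 : ℝ)) (fun j (t : Fin d × Fin d × LSite d) => SideTouches (Ω j) t.2.2 t.2.1)
      (fun t => covDerivFwd η U₀ t.1 (fun z => A' z t.2.1) t.2.2) with hg_def
  have hg0 : 0 ≤ g := B8ScaledSupNorm.msup_nonneg L k hη.le _ _ _
  have hg : ∀ j, j ≤ k → ∀ (y : LSite d) (κ τ : Fin d), SideTouches (Ω j) y τ →
      ((L : ℝ) ^ j * η) ^ 2 * ‖covDerivFwd η U₀ κ (fun z => A' z τ) y‖ ≤ g := by
    intro j hj y κ τ hs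
    have h := B8ScaledSupNorm.weight_mul_norm_le_msup hBg hj (i := (κ, τ, y)) hs
    have hw : weight L η (-(2 : ℝ)) j = ((L : ℝ) ^ j * η) ^ 2 := by
      have e2 : (-(2 : ℝ)) = -((2 : ℕ) : ℝ) := by norm_num
      rw [e2, B8ScaledSupNorm.weight_neg_natCast L η 2 j]
    rw [hw] at h
    exact h
  -- `u = 1` AT BOTH END-POINTS OF A SIDE OF `Ω₀` NOT FULLY INSIDE `Ω₀` (outer end-points: support of `u`; an inner end-point with a neighbour
  -- outside is a boundary-layer site, in `Λs k 0` by `hlay`, where (1.29)₀ pins `u = 1`), so `W = U′` there and `η‖A′‖ = ‖log U′‖ ≤ 2‖U′ − 1‖ ≤ 2a`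
  have he1 : ∀ (b : LSite d × Fin d) (i : Fin d), b.1 i - 1 ≤ (b.1 + e b.2) i ∧ (b.1 + e b.2) i ≤ b.1 i + 1 := by
    intro b i
    simp only [Pi.add_apply, e_apply]
    split_ifs <;> constructor <;> omega
  have he2 : ∀ (b : LSite d × Fin d) (i : Fin d), (b.1 + e b.2) i - 1 ≤ b.1 i ∧ b.1 i ≤ (b.1 + e b.2) i + 1 := by
    intro b i
    simp only [Pi.add_apply, e_apply]
    split_ifs <;> constructor <;> omega
  have hu1 : ∀ b : LSite d × Fin d, ¬ (b.1 ∈ Ω 0 ∧ b.1 + e b.2 ∈ Ω 0) → u b.1 = 1 ∧ u (b.1 + e b.2) = 1 := by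
    intro b hnb
    refine ⟨?_, ?_⟩
    · by_cases h : b.1 ∈ Ω 0
      · exact Units.val_eq_one.mp (B8Eq119TwistedAxial.restr129_level_zero h129
          (hlay b.1 (b.1 + e b.2) h (fun h' => hnb ⟨h, h'⟩) (he1 b)))
      · exact huS _ h
    · by_cases h : b.1 + e b.2 ∈ Ω 0
      · exact Units.val_eq_one.mp (B8Eq119TwistedAxial.restr129_level_zero h129
          (hlay (b.1 + e b.2) b.1 h (fun h' => hnb ⟨h', h⟩) (he2 b)))
      · exact huS _ h
  have hcol : ∀ b : LSite d × Fin d, SideTouches (Ω 0) b.1 b.2 → ¬ (b.1 ∈ Ω 0 ∧ b.1 + e b.2 ∈ Ω 0) → η * ‖A' b.1 b.2‖ ≤ 2 * a := by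
    intro b hsd hnb
    obtain ⟨hx, hxe⟩ := hu1 b hnb
    -- `W_b = U′_b`
    have hWb : W b.1 b.2 = U' b.1 b.2 := by
      have h := congrFun (congrFun hW b.1) b.2
      rw [mgauge_apply, hx, hxe, one_mul] at h
      simpa using h
    -- `A′_b = (1/iη) log W_b`
    have hmem : (b.1, b.2) ∈ M := ⟨0, Nat.zero_le _, hsd⟩
    have hA'b : A' b.1 b.2 = η⁻¹ • ((I⁻¹ : ℂ) • mlog ((W b.1 b.2 : 𝔸ˣ) : 𝔸)) := by
      simp only [hA'_def, Set.indicator_of_mem hmem]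
    have hU'1 : ‖((U' b.1 b.2 : 𝔸ˣ) : 𝔸) - 1‖ ≤ 1 / 2 := (h66 b hsd).trans (by linarith only [ha])
    rw [hA'b, hWb, norm_smul, norm_smul, norm_inv, norm_inv, Complex.norm_I, inv_one, one_mul, Real.norm_eq_abs,
      abs_of_pos hη, ← mul_assoc, mul_inv_cancel₀ hη.ne', one_mul]
    exact (MatrixLog.norm_mlog_le_two_mul hU'1).trans (by linarith only [h66 b hsd])
  -- THE EXTERIOR-COLLAR TERM `Φ₀(A′) ≤ 2a` (outer sides) and its window
  set Φ₀ : ℝ := msup L k η (-(1 : ℝ)) (fun j (b : LSite d × Fin d) => j = 0 ∧ SideTouches (Ω 0) b.1 b.2 ∧ ¬ BondTouches (Ω 0) b.1 b.2)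
      (fun b => A' b.1 b.2) with hΦ₀_def
  have hΦ₀ : Φ₀ ≤ 2 * a := by
    refine B8ScaledSupNorm.msup_le (by linarith only [ha0]) fun j hj b hb => ?_
    obtain ⟨rfl, hsd, hnb⟩ := hb
    have e1 : (-(1 : ℝ)) = -((1 : ℕ) : ℝ) := by norm_num
    rw [e1, B8ScaledSupNorm.weight_neg_natCast L η 1 0, pow_one, pow_zero, one_mul]
    exact hcol b hsd fun h => hnb (Or.inl h.1)
  have hΦ₀0 : 0 ≤ Φ₀ := B8ScaledSupNorm.msup_nonneg L k hη.le _ _ _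
  have hβ : Bbd * Φ₀ + Bbd * Φ₀ ≤ ((d : ℝ) * L - 1) * B₀ * (α₀ + α₁) := by
    have h1 := mul_le_mul_of_nonneg_left hΦ₀ hBbd
    linarith only [h1, hbdry]
  -- PROPOSITION 3 at `k` levels for `A′`: (1.55) (`eq155_norm_kLevel_hermitian`), «|B₁|β < 2dLα₁ + C₂α₂²» — on the constraint bonds by (1.42) + (1.37)
  -- (`norm_B1_lt_kLevel`), on a level-0 CROSSING bond `Q₀ = 1` and the term is `η‖A′(b)‖ ≤ 2a ≤ 2dLα₁` (`hcol`, `haα`) — then the bootstrap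
  -- (`apriori_160_bdry`) and the slack of (1.60) ⇒ (1.62) absorbing the collar allowance (`apriori_162_bdry`)
  have h₀ : ∀ y κ, U₀ y κ ∈ U1 𝔸 := fun y κ => unitaryUnits_le_U1 (hU₀ y κ)
  have h55 := B8Eq155KLevelLocal.eq155_norm_kLevel_hermitian hη hL1 h₀ hA'sa hα₀.le hα₂ h16 hd5 hg0 h40₀ h40₁
    (fun j hj y τ hs => (hA'41 j hj y τ hs).2) hg
  have h41'' : ∀ j, j ≤ k → ∀ x μ, BondTouches (Ω j) x μ → ‖A' x μ‖ ≤ α₂ * ((L : ℝ) ^ j * η)⁻¹ :=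
    fun j hj x μ hb => B8Prop3KLevel.bound_of_sideTouches hd2 (fun y τ hs => (hA'41 j hj y τ hs).2) x μ hb
  have hd' : (1 : ℝ) ≤ d := by exact_mod_cast (le_trans (by norm_num) hd2)
  have hdL : (1 : ℝ) ≤ (d : ℝ) * L := one_le_mul_of_one_le_of_one_le hd' hLr
  have hC0 : 0 ≤ 8 * (131072 * ((d : ℝ) + 1) ^ 2) * Real.exp (4 * (800 * ((d : ℝ) + 1) ^ 2 * ((d : ℝ) + 4)) * ((L : ℝ) ^ 2 * α₀)) * (L : ℝ) ^ 2 * α₂ ^ 2 := by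
    positivity
  haveI : Nontrivial (Fin d) := Fin.nontrivial_iff_two_le.mpr hd2
  obtain ⟨ha', hg', -, -⟩ := B8Prop3KLevelBdry.apriori_160_bdry (L := (L : ℝ)) (B₀ := B₀) (α₁ := α₁)
    (C₂ := 8 * (131072 * ((d : ℝ) + 1) ^ 2) * Real.exp (4 * (800 * ((d : ℝ) + 1) ^ 2 * ((d : ℝ) + 4)) * ((L : ℝ) ^ 2 * α₀)) * (L : ℝ) ^ 2)
    (Nat.cast_nonneg d) hB₀ hα₂ hg0 h55
    (by
      refine B8Eq155JBound.wsup_le (fun p => ?_) (by positivity)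
      obtain ⟨⟨j, b⟩, hj, hc | ⟨hj0, hcr⟩⟩ := p
      · have hj' : j ≤ k := hj
        have hc' : b ∈ Λb k j := hc
        show 1 * ‖linCovIter L U₀ (iEta η A') j b.1 b.2‖ ≤ _
        rw [one_mul]
        exact (norm_B1_lt_kLevel_γ hη L hL (avgClosed_unitaryUnits d L) U₀ hU₀ hα₀ hα3 hα4 A' hα₂ hsmall hc₃
          hbox h40₀ h41'' h42 hj' hc').le
      · have hj0' : j = 0 := hj0
        subst hj0'
        have hbt' : BondTouches (Ω 0) b.1 b.2 := hcr.1
        have hnb' : ¬ (b.1 ∈ Ω 0 ∧ b.1 + e b.2 ∈ Ω 0) := hcr.2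
        show 1 * ‖linCovIter L U₀ (iEta η A') 0 b.1 b.2‖ ≤ _
        rw [one_mul, B7Prop4GeneralLevels.linCovIter_zero, B8Eq154Local.norm_iEta_apply hη.le]
        obtain ⟨κ, hκ⟩ := exists_ne b.2
        have hsd : SideTouches (Ω 0) b.1 b.2 := B8Eq140Level.sideTouches_of_bondTouches hκ hbt'
        have h1 : 2 * a ≤ 2 * d * L * α₁ := by linarith only [haα]
        linarith only [hcol b hsd hnb', h1, hC0])
    h59a h59g h59a h59a hside h50
  set R₀ := B₀ * (4 * α₀ + 4 * d * L * α₁ + 2 * α₂ ^ 2 + 20 * d * α₀ * α₂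
      + 2 * (8 * (131072 * ((d : ℝ) + 1) ^ 2) * Real.exp (4 * (800 * ((d : ℝ) + 1) ^ 2 * ((d : ℝ) + 4)) * ((L : ℝ) ^ 2 * α₀)) * (L : ℝ) ^ 2)
        * α₂ ^ 2) with hR₀
  set R₁ := B₀ * (4 * α₀ + 4 * d * L * α₁ + 2 * α₂ ^ 2 + 20 * d * α₀ * α₂ + 2 * C₂ * α₂ ^ 2) with hR₁
  have hR : R₀ ≤ R₁ := by
    rw [hR₀, hR₁]
    apply mul_le_mul_of_nonneg_left _ hB₀
    have hsq : 0 ≤ α₂ ^ 2 := sq_nonneg _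
    have hCC := mul_le_mul_of_nonneg_right hC₂ hsq
    linarith only [hCC]
  have h162a : R₁ + (Bbd * Φ₀ + Bbd * Φ₀) ≤ 5 * d * L * B₀ * (α₀ + α₁) := by
    rw [hR₁]; exact B8Prop3KLevelBdry.apriori_162_bdry hB₀ hdL hα₀.le h61 hβ
  have ha : msup L k η (-(1 : ℝ)) (fun j (b : LSite d × Fin d) => SideTouches (Ω j) b.1 b.2) (fun b => A' b.1 b.2)
      ≤ 5 * d * L * B₀ * (α₀ + α₁) := by linarith only [ha', hR, h162a]
  -- the SECOND member: `g ≤ R₀ + 2·B_∂Φ₀` from the bootstrap, absorbed by the same slack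
  have hgfin : g ≤ 5 * d * L * B₀ * (α₀ + α₁) := by linarith only [hg', hR, h162a]
  refine ⟨A', hA'sa, fun j hj y τ hs => (hsock j hj y τ hs).1, fun j hj y τ hs => ?_, fun j hj y κ τ hs => ?_⟩
  · -- (1.62)₁ pointwise on the side, back to `A`
    have hpt := B8ScaledSupNorm.norm_le_of_msup_le hL1 hη hBa ha hj (i := (y, τ)) hs
    rw [Real.rpow_neg_one] at hpt
    obtain ⟨hAA, -, -⟩ := hsock j hj y τ hs
    rw [← hAA, hc]
    exact hpt
  · -- (1.62)₂
    rw [hc]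
    exact (hg j hj y κ τ hs).trans hgfin


end Generic

end Summit.QuantumFields.YangMills.Theorems.HalvingP1FlatCoreTopSizesGamma

end
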